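import Literature.AlgebraicGeometry.Resolution.Temkin2008Localization
import Literature.AlgebraicGeometry.Resolution.ResolutionOfComponents
import Literature.AlgebraicGeometry.Resolution.QuasiExcellentField
import HarnessLib

/-!
# Hironaka's theorem over local rings contains the field case (`Hironaka1964_local → Hironaka1964`)

Topic: `Literature/AlgebraicGeometry/Resolution`. Companion of `Temkin2008Localization.lean`
(proofs only, no new notions, no new named facts). The named fact `Hironaka1964_local` (Hironaka
1964, Main Theorem I, in the generality recorded by Temkin 2008, p. 3: "any integral scheme of
finite type over a local quasi-excellent ring of residue characteristic zero admits a …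
resolution of singularities") is the leaf of the decomposition of `Temkin2008`; the tree reaches
the field statement `Hironaka1964` (`ResolutionInChar 0`: reduced separated schemes of finite type
over a field of characteristic zero have a proper birational regular model) from it only through
`temkin2008_of_localization` and `Temkin2008.hironaka1964`, i.e. modulo the further named facts
`Stacks07QU`, `Stacks07QU_localization`, `Stacks07QW_field`. None of them is needed: a field `k`
of characteristic zero is itself a local quasi-excellent ring (`isQuasiExcellentRing_of_field`,
PROVED) whose residue field `k/(0)` has characteristic zero, so `Hironaka1964_local` applies over
the base `Spec k` directly.

* `charZero_residueField_of_field` — the residue field of a field of characteristic zero, seen as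
  a local ring, has characteristic zero;
* `Hironaka1964_local.resolutionOver_field` — `ResolutionOver (Spec k)` for every field `k` of
  characteristic zero (every integral `k`-scheme of finite type admits a desingularization in
  Temkin's sense: an `X_reg`-admissible blow-up with regular source);
* `Hironaka1964_local.integralResolutionInChar_zero`, `Hironaka1964_local.hironaka1964` — hence
  `IntegralResolutionInChar 0` and (reduced case via the components, `hironaka1964_iff_integral`)
  the named fact `Hironaka1964`, with trust base the single leaf `Hironaka1964_local`.

## Sources

* M. Temkin, *Desingularization of quasi-excellent schemes in characteristic zero*, Adv. Math.
  219 (2008) 488–522 = arXiv:math/0703678, §1 p. 3 and Thm. 2.3.6 (p. 13) (arXiv pagination).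
  [Temkin2008]
* H. Hironaka, *Resolution of singularities of an algebraic variety over a field of
  characteristic zero I*, Ann. of Math. 79 (1964) 109–203, Main Theorem I. [Hironaka1964]
-/

noncomputable section

open CategoryTheory AlgebraicGeometry TopologicalSpace IsLocalRing

namespace Literature.AlgebraicGeometry.Resolution

universe u

/-- The residue field `k ⧸ 𝔪 = k ⧸ (0)` of a field `k` of characteristic zero, regarded as a local
ring, has characteristic zero: every nonzero natural number is a unit of `k`, hence of the
(nontrivial) residue field. [folklore] -/
theorem charZero_residueField_of_field (k : Type u) [Field k] [CharZero k] :
    CharZero (ResidueField k) :=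
  charZero_of_ringHom_of_isUnit_natCast (residue k) fun _ hn =>
    isUnit_iff_ne_zero.mpr (Nat.cast_ne_zero.mpr hn)

/-- **Hironaka's theorem over local rings gives resolution of singularities over every field of
characteristic zero** (Temkin 2008, Def. 2.3.1: every integral `k`-scheme of finite type admits a
desingularization): a field is a local quasi-excellent ring (`isQuasiExcellentRing_of_field`)
with residue field of characteristic zero. [cite: Temkin2008, §1 p. 3 and Thm. 2.3.6] -/
theorem Hironaka1964_local.resolutionOver_field (hH : Hironaka1964_local.{u}) (k : Type u)
    [Field k] [CharZero k] : ResolutionOver (Spec (.of k)) :=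
  hH k (isQuasiExcellentRing_of_field k) (charZero_residueField_of_field k)

/-- **Integral separated schemes of finite type over a field of characteristic zero have a
resolution, from `Hironaka1964_local` alone** (`IntegralResolutionInChar 0`): such a scheme is
Noetherian, and a desingularization of a locally Noetherian integral scheme is a resolution
(`Scheme.AdmitsDesingularization.hasResolution`). Separatedness is not used.
[cite: Temkin2008, §1 p. 3 and Thm. 2.3.6] -/
theorem Hironaka1964_local.integralResolutionInChar_zero (hH : Hironaka1964_local.{u}) :
    IntegralResolutionInChar.{u} 0 := by
  intro k _ _ X f _hsep hft hqc hint
  haveI : CharZero k := CharP.charP_to_charZero k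
  haveI := hft
  haveI := hqc
  haveI := hint
  haveI : IsNoetherian X := Scheme.isNoetherian_of_finiteType_over_field f
  exact (hH.resolutionOver_field k X f).hasResolution

/-- **`Hironaka1964_local → Hironaka1964`**: Hironaka's Main Theorem I over local quasi-excellent
rings of residue characteristic zero (Temkin's reading) contains the weak field statement
`Hironaka1964` (= `ResolutionInChar 0`; the reduced case from the integral one via the irreducible
components, `hironaka1964_iff_integral`). [cite: Hironaka1964, Main Theorem I]
[cite: Temkin2008, §1 p. 3] -/
theorem Hironaka1964_local.hironaka1964 (hH : Hironaka1964_local.{u}) : Hironaka1964.{u} :=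
  hironaka1964_iff_integral.mpr hH.integralResolutionInChar_zero

end Literature.AlgebraicGeometry.Resolution

end
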